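import Summits.ValiantsHypothesis.ValiantsHypothesis.Theorems.KPlusLogSqLawTropicalBSplit

/-!
# Route `KPlusLogSqLaw`, crux `TropicalB` — the HALVING INEQUALITY for the unsigned tropical row

HONEST FRAMING.  Helper file toward the registered stubs `stub_tropThin` / `stub_tropFat` of
`Cruxes/TropicalB/Lines/birth.lean` (crux `Summit.ValiantsHypothesis.ValiantsHypothesis.Theses.KPlusLogSqLaw.TropicalB`,
ledger item `stmt-ValiantsHypothesis-19771`, route `KPlusLogSqLaw`, DRAFT; cell `pub-symmetroid`, seat `val-sym-trop-p1`,
2026-08-26).  Nothing here proves any part of a stub; nothing asserts `TropicalB`, `KPlusLogSqLaw`, `MatrixDescartes`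
or anything about `VP ≠ VNP`.

The split inequality (`designRowD_split`, companion file) with ALL `c`-subsets of rows as states:

* `tropRowD_halving : TropRowD c K B₁ → TropRowD e K B₂ → TropRowD (c + e) K (C(c+e, c)·(B₁ + B₂ + 1) − 1)`,

the tropical twin, in the dominance vocabulary, of the upper half of Hrubeš–Yehudayoff's Prop. 23 (a plane shadow of the
Birkhoff polytope `B_{2n}` has at most `2·C(2n, n)·σ(B_n)`-type many vertices), hence `T(m, K) ≤ 2^{(2+o(1))m}` for every
`K` — worth nothing inside the window `log₂ m + 1 < K < m` of the `K + log² m` law (counting is better there), recorded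
only as the general instance of the split.  The useful instance is the Hessenberg one (companion file), where `c + 1`
states replace `C(c+e, c)`.  [folklore; doi:10.4230/LIPIcs.CCC.2021.9 Prop. 23 for the shadow form]
-/

set_option linter.dupNamespace false
set_option autoImplicit false

namespace Summit.ValiantsHypothesis.ValiantsHypothesis.Theorems.KPlusLogSqLaw

open Summit.ValiantsHypothesis.ValiantsHypothesis.Theorems.MatrixDescartes.Negative
open Summit.ValiantsHypothesis.ValiantsHypothesis.Theorems.LacunarySymmetroidMatrixDescartes
open Summit.ValiantsHypothesis.ValiantsHypothesis.Theorems.LacunarySymmetroidMatrixDescartes.TropicalCensus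
open scoped BigOperators
open Finset

/-- the first-block row set of any Leibniz term of format `c + e` is a `c`-subset. [folklore] -/
theorem card_image_castAdd {c e K : ℕ} (q : Equiv.Perm (Fin (c + e)) × (Fin (c + e) → Fin K)) :
    ((univ : Finset (Fin c)).image fun j => q.1 (Fin.castAdd e j)).card = c := by
  have hinj : Function.Injective fun j : Fin c => q.1 (Fin.castAdd e j) :=
    q.1.injective.comp (Fin.castAdd_injective _ _)
  rw [card_image_of_injective _ hinj, card_univ, Fintype.card_fin]

/-- **Halving inequality** (all `c`-subsets as states): `TropRowD c K B₁ → TropRowD e K B₂ →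
TropRowD (c + e) K (C(c+e, c)·(B₁ + B₂ + 1) − 1)`. [folklore; tropical form of doi:10.4230/LIPIcs.CCC.2021.9 Prop. 23] -/
theorem tropRowD_halving {c e K B₁ B₂ : ℕ} (h₁ : TropRowD c K B₁) (h₂ : TropRowD e K B₂) :
    TropRowD (c + e) K ((c + e).choose c * (B₁ + B₂ + 1) - 1) := by
  classical
  intro d v ε
  have hcard : ((univ : Finset (Fin (c + e))).powersetCard c).card = (c + e).choose c := by
    rw [card_powersetCard, card_univ, Fintype.card_fin]
  rw [← hcard]
  refine designRowD_split d v ε _ (fun R hR => (mem_powersetCard.mp hR).2) (fun R _ r _ => h₁ _ _ _)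
    (fun R _ r _ => h₂ _ _ _) ?_
  intro q _
  rw [mem_powersetCard]
  exact ⟨subset_univ _, card_image_castAdd q⟩

/-- the halving inequality at `m + m`: `T_D(2m) + 1 ≤ C(2m, m)·(2·T_D(m) + 1)`. [folklore] -/
theorem tropRowD_double {m K B : ℕ} (h : TropRowD m K B) :
    TropRowD (m + m) K ((m + m).choose m * (B + B + 1) - 1) :=
  tropRowD_halving h h

/-- the signed row inherits the halving inequality. [folklore] -/
theorem tropRootLawAt_halving {c e K B₁ B₂ : ℕ} (h₁ : TropRowD c K B₁) (h₂ : TropRowD e K B₂) :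
    TropRootLawAt (c + e) K ((c + e).choose c * (B₁ + B₂ + 1) - 1) :=
  tropRootLawAt_of_tropRowD (tropRowD_halving h₁ h₂)

end Summit.ValiantsHypothesis.ValiantsHypothesis.Theorems.KPlusLogSqLaw
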